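import Mathlib
import Literature.Computability.AlgebraicComplexity.NestFreeMatchingPoly
import Literature.Computability.AlgebraicComplexity.MonotoneStructure
import HarnessLib

/-!
# Route `FifoMatching`, crux `NNLinearDegreeCofactorHard` (stmt-ValiantsHypothesis-23918), line
# `internal_cofactor`: RIGIDITY WITH DEFECTS for stub S2b `stub_denseInternalHard` (part (i))

The registered line `Cruxes/NNLinearDegreeCofactorHard/Lines/internal_cofactor.lean` isolates the new
content of the crux in stub S2b: for an INTERNAL cofactor `p ≠ 0` on a small everywhere-dense vertex set
`R ⊆ [2n]` (every arc of every monomial of `p` inside `R × R`), `2^((log₂ n + c)^c) < L₊(NN_n · p)`.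
Its intended proof has three parts: (i) rigidity with defects, (ii) a defect-robust spread measure,
(iii) the union bound.  This file proves part (i), the exact analogue WITH DEFECTS of
`exists_balanced_vertex_split` (`Theorems/FifoMatchingNNMonotoneHardReduction.lean`); the companion file
`…DefectSplitReduction.lean` proves (iii) and reduces S2b verbatim to (ii).

* `isVertex_iff_not_isVertex`, `isVertex_iff_isVertex_partner` — bookkeeping: if `g + h = x^M + A`
  with `M` a perfect matching of `Fin m` and `A` supported on `R × R`, then OUTSIDE `R` every vertex is
  a vertex of exactly one of `g`, `h`, and the vertex set of `g` is a union of arcs of `M`;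
* `card_filter_isVertex_le` — an exponent vector `g` has at most `2 · deg g` vertices;
* `exists_defect_vertex_split` — **balanced products live on one vertex split OFF the defects.**  If
  every monomial of `F` is `x^M · x^A` of that shape (e.g. `F = (Σ_{M ∈ 𝓕} x^M) · q` with `q` internal
  on `R`), and `a · b ≠ 0`, `a · b ≤ F` coefficientwise, then there is ONE set `I ⊆ Rᶜ` — with
  `|I| ≤ 2 deg g` for every monomial `g` of `a` and `m ≤ |I| + |R| + 2 deg h` for every monomial `h`
  of `b` — such that for EVERY way of writing a monomial of `a · b` as `x^M · x^A` of that shape no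
  arc of `M` joins `I` to `Rᶜ ∖ I` (`∀ i ∉ R, M i ∉ R → (i ∈ I ↔ M i ∈ I)`; arcs touching `R` exempt).

Why the decomposition is quantified universally: with defects `x = x^M · x^A` is NOT unique (arcs of
`M` inside `R × R` can be traded against `A`), but all decompositions of one monomial agree on every
arc touching `Rᶜ`, which is all the split condition sees — so the union bound needs no injectivity.

Honest framing: bookkeeping about ONE candidate family in the monotone world
(`Literature.Barriers.ValiantsHypothesis.MonotoneGap`: monotone ≠ general); stub S2b, the crux
`NNLinearDegreeCofactorHard`, `NNDivisionHard`, `NNNotVP` stay OPEN, and VP ≠ VNP is NOT proved by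
anything here.  No definitions, no named facts.
-/

noncomputable section

-- Sub = Summit single-conjunct layout: the duplicated namespace component is mandated by the tree.
set_option linter.dupNamespace false

namespace Summit.ValiantsHypothesis.ValiantsHypothesis.Theorems.FifoMatching.NNLinearDegreeCofactorHard.DefectSplit

open MvPolynomial Finset Literature.Computability.AlgebraicComplexity
open scoped NNReal

variable {m : ℕ}

/-! ### Sub-arc-sets of a perfect matching plus an internal defect -/

section Defect

variable {R : Finset (Fin m)} {M : Fin m → Fin m} {g h A : (Fin m × Fin m) →₀ ℕ}

/-- An exponent vector supported on `R × R` vanishes at every pair whose first entry is outside `R`.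
[folklore] -/
theorem defect_apply_eq_zero_left (hA : ∀ e ∈ A.support, e.1 ∈ R ∧ e.2 ∈ R) {i : Fin m}
    (hi : i ∉ R) (j : Fin m) : A (i, j) = 0 := by
  by_contra hne
  exact hi (hA (i, j) (Finsupp.mem_support_iff.2 hne)).1

/-- An exponent vector supported on `R × R` vanishes at every pair whose second entry is outside `R`.
[folklore] -/
theorem defect_apply_eq_zero_right (hA : ∀ e ∈ A.support, e.1 ∈ R ∧ e.2 ∈ R) {i : Fin m}
    (hi : i ∉ R) (j : Fin m) : A (j, i) = 0 := by
  by_contra hne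
  exact hi (hA (j, i) (Finsupp.mem_support_iff.2 hne)).2

/-- If `g + h = x^M + A` with `A` supported on `R × R`, then `g` vanishes at every non-arc of `M`
touching a vertex outside `R`. [folklore] -/
theorem apply_eq_zero_of_add_eq (hgh : g + h = arcExponent M + A)
    (hA : ∀ e ∈ A.support, e.1 ∈ R ∧ e.2 ∈ R) {i j : Fin m} (hij : i ∉ R ∨ j ∉ R)
    (hM : ¬ (i < M i ∧ M i = j)) : g (i, j) = 0 := by
  have hA0 : A (i, j) = 0 := by
    rcases hij with hi | hj
    · exact defect_apply_eq_zero_left hA hi j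
    · exact defect_apply_eq_zero_right hA hj i
  have e := congrArg (fun f => f (i, j)) hgh
  simp only [Finsupp.coe_add, Pi.add_apply, arcExponent_apply, if_neg hM, hA0] at e
  omega

/-- If `g + h = x^M + A` with `A` supported on `R × R`, then on an arc of `M` touching a vertex
outside `R` the values of `g` and `h` add up to `1`. [folklore] -/
theorem apply_add_apply_eq_one_of_add_eq (hgh : g + h = arcExponent M + A)
    (hA : ∀ e ∈ A.support, e.1 ∈ R ∧ e.2 ∈ R) {i : Fin m} (hiR : i ∉ R ∨ M i ∉ R)
    (hi : i < M i) : g (i, M i) + h (i, M i) = 1 := by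
  have hA0 : A (i, M i) = 0 := by
    rcases hiR with hi' | hj
    · exact defect_apply_eq_zero_left hA hi' (M i)
    · exact defect_apply_eq_zero_right hA hj i
  simpa [Finsupp.coe_add, Pi.add_apply, arcExponent_apply, hi, hA0] using
    congrArg (fun f => f (i, M i)) hgh

/-- The vertex predicate of `g` (with `g + h = x^M + A`, `A` on `R × R`) at an opener `i ∉ R`:
`i` is a vertex of `g` iff the arc `(i, M i)` belongs to `g`. [folklore] -/
theorem isVertex_iff_of_lt (hM : M ∈ perfectMatchings m) (hgh : g + h = arcExponent M + A)
    (hA : ∀ e ∈ A.support, e.1 ∈ R ∧ e.2 ∈ R) {i : Fin m} (hiR : i ∉ R) (hi : i < M i) :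
    (∃ j, g (i, j) ≠ 0 ∨ g (j, i) ≠ 0) ↔ g (i, M i) ≠ 0 := by
  obtain ⟨hinv, -⟩ := mem_perfectMatchings.1 hM
  constructor
  · rintro ⟨j, hj | hj⟩
    · by_cases hc : i < M i ∧ M i = j
      · rw [← hc.2] at hj; exact hj
      · exact absurd (apply_eq_zero_of_add_eq hgh hA (Or.inl hiR) hc) hj
    · by_cases hc : j < M j ∧ M j = i
      · exfalso
        have : M i = j := by rw [← hc.2, hinv]
        rw [this] at hi
        exact lt_asymm hi (hc.2 ▸ hc.1)
      · exact absurd (apply_eq_zero_of_add_eq hgh hA (Or.inr hiR) hc) hj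
  · intro hg
    exact ⟨M i, Or.inl hg⟩

/-- The vertex predicate at a closer `i ∉ R` (`M i < i`): `i` is a vertex of `g` iff the arc
`(M i, i)` belongs to `g`. [folklore] -/
theorem isVertex_iff_of_gt (hM : M ∈ perfectMatchings m) (hgh : g + h = arcExponent M + A)
    (hA : ∀ e ∈ A.support, e.1 ∈ R ∧ e.2 ∈ R) {i : Fin m} (hiR : i ∉ R) (hi : M i < i) :
    (∃ j, g (i, j) ≠ 0 ∨ g (j, i) ≠ 0) ↔ g (M i, i) ≠ 0 := by
  obtain ⟨hinv, -⟩ := mem_perfectMatchings.1 hM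
  constructor
  · rintro ⟨j, hj | hj⟩
    · by_cases hc : i < M i ∧ M i = j
      · exact absurd hi (lt_asymm hc.1)
      · exact absurd (apply_eq_zero_of_add_eq hgh hA (Or.inl hiR) hc) hj
    · by_cases hc : j < M j ∧ M j = i
      · have : M i = j := by rw [← hc.2, hinv]
        rw [this]; exact hj
      · exact absurd (apply_eq_zero_of_add_eq hgh hA (Or.inr hiR) hc) hj
  · intro hg
    exact ⟨M i, Or.inr hg⟩

/-- **Outside the defects, every vertex is a vertex of exactly one of `g`, `h`** (when
`g + h = x^M + A`, `M` a perfect matching, `A` on `R × R`). [folklore] -/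
theorem isVertex_iff_not_isVertex (hM : M ∈ perfectMatchings m)
    (hgh : g + h = arcExponent M + A) (hA : ∀ e ∈ A.support, e.1 ∈ R ∧ e.2 ∈ R) {i : Fin m}
    (hiR : i ∉ R) :
    (∃ j, g (i, j) ≠ 0 ∨ g (j, i) ≠ 0) ↔ ¬ ∃ j, h (i, j) ≠ 0 ∨ h (j, i) ≠ 0 := by
  obtain ⟨hinv, hfp⟩ := mem_perfectMatchings.1 hM
  have hhg : h + g = arcExponent M + A := by rw [add_comm]; exact hgh
  rcases lt_or_gt_of_ne (hfp i).symm with hi | hi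
  · rw [isVertex_iff_of_lt hM hgh hA hiR hi, isVertex_iff_of_lt hM hhg hA hiR hi]
    have := apply_add_apply_eq_one_of_add_eq hgh hA (Or.inl hiR) hi
    omega
  · rw [isVertex_iff_of_gt hM hgh hA hiR hi, isVertex_iff_of_gt hM hhg hA hiR hi]
    have hlt : M i < M (M i) := by rwa [hinv]
    have hR' : M i ∉ R ∨ M (M i) ∉ R := Or.inr (by rw [hinv]; exact hiR)
    have := apply_add_apply_eq_one_of_add_eq hgh hA hR' hlt
    rw [hinv] at this
    omega

/-- **Outside the defects, the vertex set of `g` is a union of arcs of `M`**: for `i ∉ R` with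
`M i ∉ R`, `i` is a vertex of `g` iff `M i` is. [folklore] -/
theorem isVertex_iff_isVertex_partner (hM : M ∈ perfectMatchings m)
    (hgh : g + h = arcExponent M + A) (hA : ∀ e ∈ A.support, e.1 ∈ R ∧ e.2 ∈ R) {i : Fin m}
    (hiR : i ∉ R) (hMiR : M i ∉ R) :
    (∃ j, g (i, j) ≠ 0 ∨ g (j, i) ≠ 0) ↔ ∃ j, g (M i, j) ≠ 0 ∨ g (j, M i) ≠ 0 := by
  obtain ⟨hinv, hfp⟩ := mem_perfectMatchings.1 hM
  rcases lt_or_gt_of_ne (hfp i).symm with hi | hi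
  · have hi' : M (M i) < M i := by rw [hinv]; exact hi
    rw [isVertex_iff_of_lt hM hgh hA hiR hi, isVertex_iff_of_gt hM hgh hA hMiR hi', hinv]
  · have hi' : M i < M (M i) := by rw [hinv]; exact hi
    rw [isVertex_iff_of_gt hM hgh hA hiR hi, isVertex_iff_of_lt hM hgh hA hMiR hi', hinv]

end Defect

/-- The vertices of an exponent vector `g` on `Fin m × Fin m` inside any set `s` number at most
`2 · deg g` (each point of the support contributes its two entries). [folklore] -/
theorem card_filter_isVertex_le (s : Finset (Fin m)) (g : (Fin m × Fin m) →₀ ℕ) :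
    (s.filter fun i => ∃ j, g (i, j) ≠ 0 ∨ g (j, i) ≠ 0).card ≤ 2 * g.degree := by
  classical
  calc (s.filter fun i => ∃ j, g (i, j) ≠ 0 ∨ g (j, i) ≠ 0).card
      ≤ (g.support.image Prod.fst ∪ g.support.image Prod.snd).card := by
        refine card_le_card fun i hi => ?_
        obtain ⟨-, j, hj | hj⟩ := mem_filter.1 hi
        · exact mem_union_left _ (mem_image.2 ⟨(i, j), Finsupp.mem_support_iff.2 hj, rfl⟩)
        · exact mem_union_right _ (mem_image.2 ⟨(j, i), Finsupp.mem_support_iff.2 hj, rfl⟩)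
    _ ≤ g.support.card + g.support.card :=
        (card_union_le _ _).trans (add_le_add card_image_le card_image_le)
    _ = 2 * ∑ e ∈ g.support, 1 := by rw [sum_const, smul_eq_mul, mul_one]; ring
    _ ≤ 2 * g.degree := by
        rw [Finsupp.degree_apply]
        exact Nat.mul_le_mul_left 2 (sum_le_sum fun e he =>
          Nat.one_le_iff_ne_zero.2 (Finsupp.mem_support_iff.1 he))

/-! ### Balanced products live on one vertex split off the defects -/

/-- **Rigidity with defects.** Let every monomial of `F ∈ ℝ≥0[x_(i,j)]` be of the form `x^M · x^A`
with `M` a perfect matching of `Fin m` and `A` supported on `R × R` (e.g. `F = (Σ_{M ∈ 𝓕} x^M) · q`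
with `q` internal on `R`).  If `a · b ≠ 0` and `a · b ≤ F` coefficientwise, then there is ONE set
`I ⊆ Rᶜ` with `|I| ≤ 2 · deg g` for every monomial `g` of `a` and `m ≤ |I| + |R| + 2 · deg h` for
every monomial `h` of `b`, such that for every monomial of `a · b` and EVERY decomposition of it as
`x^M · x^A` of that shape, no arc of `M` joins `I` to `Rᶜ ∖ I`.  Proof: fix a monomial `h₀` of `b`
and let `I` be the set of points outside `R` that are not vertices of `h₀`; for a monomial `g` of `a`,
`g + h₀ = x^{M₀} + A₀`, and outside `R` every vertex is covered once, by `g` or by `h₀` — so the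
vertices of `g` outside `R` are exactly `I`, and those of any partner `h` are exactly `Rᶜ ∖ I`; on a
monomial `g + h = x^M + A` an arc of `M` with both ends outside `R` lies in `g` or in `h`, whence both
ends are in `I` or both outside. [folklore] -/
theorem exists_defect_vertex_split (R : Finset (Fin m))
    {F a b : MvPolynomial (Fin m × Fin m) ℝ≥0}
    (hF : ∀ x ∈ F.support, ∃ M ∈ perfectMatchings m, ∃ A : (Fin m × Fin m) →₀ ℕ,
      (∀ e ∈ A.support, e.1 ∈ R ∧ e.2 ∈ R) ∧ arcExponent M + A = x)
    (hab : a * b ≠ 0) (hle : ∀ x, coeff x (a * b) ≤ coeff x F) :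
    ∃ I : Finset (Fin m), (∀ i ∈ I, i ∉ R) ∧
      (∀ g ∈ a.support, I.card ≤ 2 * g.degree) ∧
      (∀ h ∈ b.support, m ≤ I.card + R.card + 2 * h.degree) ∧
      ∀ x ∈ (a * b).support, ∀ M ∈ perfectMatchings m, ∀ A : (Fin m × Fin m) →₀ ℕ,
        (∀ e ∈ A.support, e.1 ∈ R ∧ e.2 ∈ R) → arcExponent M + A = x →
          ∀ i, i ∉ R → M i ∉ R → (i ∈ I ↔ M i ∈ I) := by
  classical
  -- every monomial below `F` is a matching plus an internal defect
  have hmem : ∀ x ∈ (a * b).support, ∃ M ∈ perfectMatchings m, ∃ A : (Fin m × Fin m) →₀ ℕ,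
      (∀ e ∈ A.support, e.1 ∈ R ∧ e.2 ∈ R) ∧ arcExponent M + A = x := by
    intro x hx
    apply hF
    rw [mem_support_iff] at hx ⊢
    exact fun h0 => hx (le_antisymm ((hle x).trans h0.le) zero_le)
  have ha0 : a ≠ 0 := fun h => hab (by rw [h, zero_mul])
  have hb0 : b ≠ 0 := fun h => hab (by rw [h, mul_zero])
  obtain ⟨h₀, hh₀⟩ := support_nonempty.2 hb0
  -- the split: the points outside `R` that are not vertices of `h₀`
  set I : Finset (Fin m) :=
    univ.filter fun i => i ∉ R ∧ ¬ ∃ j, h₀ (i, j) ≠ 0 ∨ h₀ (j, i) ≠ 0 with hI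
  have hIR : ∀ i ∈ I, i ∉ R := fun i hi => by
    rw [hI, mem_filter] at hi
    exact hi.2.1
  -- outside `R`, the vertex set of every monomial of `a` is `I`
  have hverts : ∀ g ∈ a.support, ∀ i, i ∉ R → (i ∈ I ↔ ∃ j, g (i, j) ≠ 0 ∨ g (j, i) ≠ 0) := by
    intro g hg i hi
    obtain ⟨M₀, hM₀, A₀, hA₀, hx⟩ := hmem _ (add_mem_support_mul hg hh₀)
    rw [isVertex_iff_not_isVertex hM₀ hx.symm hA₀ hi, hI, mem_filter]
    exact ⟨fun h => h.2.2, fun h => ⟨mem_univ _, hi, h⟩⟩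
  refine ⟨I, hIR, ?_, ?_, ?_⟩
  · -- `|I| ≤ 2 deg g`
    intro g hg
    refine le_trans (card_le_card fun i hi => ?_) (card_filter_isVertex_le Rᶜ g)
    rw [mem_filter, mem_compl]
    exact ⟨hIR i hi, (hverts g hg i (hIR i hi)).1 hi⟩
  · -- `m ≤ |I| + |R| + 2 deg h`: outside `R`, the vertices of `h` form the complement of `I`
    intro h hh
    obtain ⟨g, hg⟩ := support_nonempty.2 ha0
    obtain ⟨M, hM, A, hA, hx⟩ := hmem _ (add_mem_support_mul hg hh)
    have hcompl : ∀ i, i ∉ R → (i ∈ I ↔ ¬ ∃ j, h (i, j) ≠ 0 ∨ h (j, i) ≠ 0) := fun i hi => by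
      rw [hverts g hg i hi, isVertex_iff_not_isVertex hM hx.symm hA hi]
    have hcard := card_filter_add_card_filter_not (s := Rᶜ)
      (fun i => ∃ j, h (i, j) ≠ 0 ∨ h (j, i) ≠ 0)
    have h1 := card_filter_isVertex_le Rᶜ h
    have h2 : (Rᶜ.filter fun i => ¬ ∃ j, h (i, j) ≠ 0 ∨ h (j, i) ≠ 0) = I := by
      ext i
      rw [mem_filter, mem_compl]
      constructor
      · rintro ⟨hi, hP⟩
        exact (hcompl i hi).2 hP
      · intro hiI
        exact ⟨hIR i hiI, (hcompl i (hIR i hiI)).1 hiI⟩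
    rw [h2, card_compl, Fintype.card_fin] at hcard
    have hRm : R.card ≤ m := by simpa using R.card_le_univ
    omega
  · -- the split condition, for every decomposition of every monomial
    intro x hx M hM A hA hMA i hi hMi
    obtain ⟨g, hg, h, hh, rfl⟩ := Finset.mem_add.1 (support_mul a b hx)
    rw [hverts g hg i hi, hverts g hg (M i) hMi]
    exact isVertex_iff_isVertex_partner hM hMA.symm hA hi hMi

end Summit.ValiantsHypothesis.ValiantsHypothesis.Theorems.FifoMatching.NNLinearDegreeCofactorHard.DefectSplit

end
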